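import Summits.QuantumFields.BalabanUV.Beta.D1BFx.MomentTransferDefect
import Summits.QuantumFields.BalabanUV.Beta.D1BFx.FineHessianWardKronecker

/-!
# `BalabanUV.Beta.D1BFx.MomentTransferDefectTotal` — road «BF-x» for binder row D1, re-cut slot (K), row (K7) «TRANSFER-Δ» (part 3, the USE clause):
# THE WEIGHTED SUM OF THE PIECES' ROW DEFECTS IS THE ROW DEFECT OF THE TOTAL FINE KERNEL, AND IT VANISHES FROM THE TOTAL'S WARD ROW ALONE —
# `Σ_i ω_i · rowDefect n (K_i) μ ν = rowDefect n (Σ_i ω_i • K_i) μ ν = 0` given first-bond divergence-freeness (the `hWardTot` shape) and transposition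
# symmetry of the TOTAL; no Ward ∕ parity hypothesis on any piece

HONEST DEPENDENCY (page 1, mandatory): continuum YM on T⁴ ⇐ BetaPertH ∧ nine spine estimates (0/9 proved); BetaPertH ⇐ (D1) ∧ (D4) ∧
CAP+tail; G-an2-4 gates asym, D1 and NE2/3/4.  HONEST FRAMING (cell contract, verbatim): «discharging `BetaPertH` makes Bałaban's UV
stability UNCONDITIONAL — a real constructive-QFT result; it is NOT the continuum limit and NOT the Clay problem.»  [folklore] bookkeeping composed
BY NAME from parts 1–2 (`MomentTransferCross.bondSecondMomentP_solutionOp_four_cross`, `MomentTransferDefect.rowDefect` ∕ `rowDefect_add` ∕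
`rowDefect_smul`), leaf-02-g4's Kronecker-Ward END `FineHessianWardKronecker.bondSecondMomentP_solutionOp_four_of_divFree` (first-bond
divergence-freeness + transposition symmetry ⟹ the K-R5 transfer at the entries `κ, λ ∈ {a, b}`) and `ReducedKernelSandwich.absMoment₂_add'`; no `def`,
no `Prop` fact, nothing of the manuscripts under audit asserted or cited; 0∕4 row-D1 binders; slot (K) NOT closed; nothing of D1 ∕ BetaPertH discharged.
Value = the cancellation step of the re-cut END's assembly (K6c) (owner spec `HOME/b2b-balaban-beta-d1-p2/K-END-RECUT-SPEC.md` §5 (K7) USE clause,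
ruling ρ-g7-9: «apply (K7) to each piece … and cancel `Σ_pieces ω_piece·rowDefect(piece) = rowDefect(Ktot) = 0` by LINEARITY + `hWardTot`»), made a
ONE-LINE invocation: `sum_rowDefect_eq_zero_of_divFree`.  NOT summit progress; NOT continuum, NOT Clay.

CONTENT (all [folklore] theorems):
* §1 CLOSURE of the transfer data under the piece algebra: `isBlockPeriodic_add` ∕ `_smul` ∕ `_zero` ∕ `_sum`, `absMoment₂_baseKer_add` ∕ `_smul` ∕
  `_zero` ∕ `_sum`; `rowDefect_zero`; **`sum_rowDefect_eq`**: `Σ_{i∈s} ω_i · rowDefect n (K_i) μ ν = rowDefect n (Σ_{i∈s} ω_i • K_i) μ ν`.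
* §2 VANISHING FROM A TRANSFER IDENTITY: `crossK_eq_zero_of_transfer` (ANY proof of the K-R5 transfer for `P` at `(κ,λ,a,b)` kills the defect there),
  **`crossK_eq_zero_of_divFree`** (block periodicity + `AbsMoment₂` + transposition symmetry `P c e s s′ = P e c s′ s` + first-bond divergence-freeness
  `Σ_c (P c e (u − e_c) u′ − P c e u u′) = 0`, at `κ, λ ∈ {a, b}`), **`rowDefect_eq_zero_of_divFree`** (the (1.22) entry `(μ,ν)` is always such an entry).
* §3 THE TOTAL: `transpose_sum_of_transpose` (a weighted sum of transposition-symmetric pieces is transposition symmetric) and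
  **`sum_rowDefect_eq_zero_of_divFree`**: pieces block periodic with absolutely summable base-point kernels, the TOTAL transposition symmetric and
  first-bond divergence-free ⟹ `Σ_{i∈s} ω_i · rowDefect n (K_i) μ ν = 0`.
-/

namespace Summit.QuantumFields.BalabanUV.Beta.D1BFx.MomentTransferDefectTotal

open Finset Filter Topology
open scoped BigOperators
open Literature.MathematicalPhysics.QuantumFieldTheory.Balaban1983to89
open Literature.MathematicalPhysics.QuantumFieldTheory.Balaban1983to89.Beta
open B12Sec2to5 (l1)
open ExpKernelCalculus (Site)
open DecimatedMomentSummable (AbsMoment₂)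
open DressedMomentNormalisation (resSite)
open MinimiserIdentityForm (wK)
open Summit.QuantumFields.BalabanUV.Beta.D1BFx.MomentTransferPeriodic (Ker₂ IsBlockPeriodic baseKer)
open Summit.QuantumFields.BalabanUV.Beta.D1BFx.MomentTransferPeriodicEntry (EKer₂ dressedEntryP avgM2)
open Summit.QuantumFields.BalabanUV.Beta.D1BFx.ReducedKernelSandwich (absMoment₂_add')
open Summit.QuantumFields.BalabanUV.Beta.D1BFx.MomentTransferCross (crossK bondSecondMomentP_solutionOp_four_cross)
open Summit.QuantumFields.BalabanUV.Beta.D1BFx.MomentTransferDefect (rowDefect rowDefect_add rowDefect_smul)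
open Summit.QuantumFields.BalabanUV.Beta.D1BFx.FineHessianWardKronecker (bondSecondMomentP_solutionOp_four_of_divFree)

variable {d N : ℕ}

/-! ## §1 Closure of the transfer data under sums and weights; the weighted sum of defects -/

section Closure

/-- [folklore] Block periodicity is additive. -/
theorem isBlockPeriodic_add {P Q : Ker₂ d} (hP : IsBlockPeriodic N P) (hQ : IsBlockPeriodic N Q) : IsBlockPeriodic N (P + Q) :=
  fun z s s' => by simp only [Pi.add_apply, hP z s s', hQ z s s']

/-- [folklore] Block periodicity is homogeneous. -/
theorem isBlockPeriodic_smul (c : ℝ) {P : Ker₂ d} (hP : IsBlockPeriodic N P) : IsBlockPeriodic N (c • P) :=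
  fun z s s' => by simp only [Pi.smul_apply, hP z s s']

/-- [folklore] The zero kernel is block periodic. -/
theorem isBlockPeriodic_zero : IsBlockPeriodic N (0 : Ker₂ d) := fun _ _ _ => rfl

/-- [folklore] Weighted finite sums of block-periodic kernels are block periodic. -/
theorem isBlockPeriodic_sum {ι : Type*} (s : Finset ι) (ω : ι → ℝ) {P : ι → Ker₂ d} (hP : ∀ i ∈ s, IsBlockPeriodic N (P i)) :
    IsBlockPeriodic N (∑ i ∈ s, ω i • P i) := by
  classical
  induction s using Finset.induction_on with
  | empty => rw [Finset.sum_empty]; exact isBlockPeriodic_zero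
  | insert i s hi ih =>
    rw [Finset.sum_insert hi]
    exact isBlockPeriodic_add (isBlockPeriodic_smul (ω i) (hP i (Finset.mem_insert_self i s)))
      (ih fun j hj => hP j (Finset.mem_insert_of_mem hj))

/-- [folklore] Absolute second-moment summability of the base-point kernels is additive. -/
theorem absMoment₂_baseKer_add {P Q : Ker₂ d} (hP : ∀ b, AbsMoment₂ (baseKer P b)) (hQ : ∀ b, AbsMoment₂ (baseKer Q b))
    (b : Fin d → ℤ) : AbsMoment₂ (baseKer (P + Q) b) :=
  (absMoment₂_add' (hP b) (hQ b)).congr fun _ => rfl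

/-- [folklore] Absolute second-moment summability of the base-point kernels is preserved by weights. -/
theorem absMoment₂_baseKer_smul (c : ℝ) {P : Ker₂ d} (hP : ∀ b, AbsMoment₂ (baseKer P b)) (b : Fin d → ℤ) :
    AbsMoment₂ (baseKer (c • P) b) := by
  refine ((hP b).mul_left |c|).congr fun t => ?_
  show |c| * ((1 + l1 t ^ 2) * |baseKer P b t|) = (1 + l1 t ^ 2) * |baseKer (c • P) b t|
  simp only [baseKer, Pi.smul_apply, smul_eq_mul, abs_mul]
  ring

/-- [folklore] The zero kernel's base-point kernels are absolutely second-moment summable. -/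
theorem absMoment₂_baseKer_zero (b : Fin d → ℤ) : AbsMoment₂ (baseKer (0 : Ker₂ d) b) := by
  refine (summable_zero (β := Fin d → ℤ) (α := ℝ)).congr fun t => ?_
  show (0 : ℝ) = (1 + l1 t ^ 2) * |baseKer (0 : Ker₂ d) b t|
  simp only [baseKer, Pi.zero_apply, abs_zero, mul_zero]

/-- [folklore] Weighted finite sums preserve absolute second-moment summability of the base-point kernels. -/
theorem absMoment₂_baseKer_sum {ι : Type*} (s : Finset ι) (ω : ι → ℝ) {P : ι → Ker₂ d} (hP : ∀ i ∈ s, ∀ b, AbsMoment₂ (baseKer (P i) b)) :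
    ∀ b : Fin d → ℤ, AbsMoment₂ (baseKer (∑ i ∈ s, ω i • P i) b) := by
  classical
  induction s using Finset.induction_on with
  | empty => rw [Finset.sum_empty]; exact absMoment₂_baseKer_zero
  | insert i s hi ih =>
    rw [Finset.sum_insert hi]
    exact absMoment₂_baseKer_add (absMoment₂_baseKer_smul (ω i) (hP i (Finset.mem_insert_self i s)))
      (ih fun j hj => hP j (Finset.mem_insert_of_mem hj))

variable (n : ℕ) [NeZero n]

/-- [folklore] The row defect of the zero kernel vanishes. -/
theorem rowDefect_zero (μ ν : Fin 4) : rowDefect n (0 : EKer₂ 4) μ ν = 0 := by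
  have h := rowDefect_smul n 0 (0 : EKer₂ 4) μ ν
  rwa [zero_smul, zero_mul] at h

/-- [folklore] **THE WEIGHTED SUM OF THE PIECES' ROW DEFECTS IS THE ROW DEFECT OF THE TOTAL** (every piece's entries block periodic with absolutely
summable base-point kernels): `Σ_{i∈s} ω_i · rowDefect n (K_i) μ ν = rowDefect n (Σ_{i∈s} ω_i • K_i) μ ν` — `rowDefect_add` ∕ `rowDefect_smul` iterated,
the intermediate totals kept periodic ∕ summable by §1. -/
theorem sum_rowDefect_eq {ι : Type*} (s : Finset ι) (ω : ι → ℝ) {K : ι → EKer₂ 4} (hK : ∀ i ∈ s, ∀ c e, IsBlockPeriodic n (K i c e))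
    (hKA : ∀ i ∈ s, ∀ c e b, AbsMoment₂ (baseKer (K i c e) b)) (μ ν : Fin 4) :
    ∑ i ∈ s, ω i * rowDefect n (K i) μ ν = rowDefect n (∑ i ∈ s, ω i • K i) μ ν := by
  classical
  induction s using Finset.induction_on with
  | empty => rw [Finset.sum_empty, Finset.sum_empty, rowDefect_zero]
  | insert i s hi ih =>
    have hPi : ∀ c e, IsBlockPeriodic n ((ω i • K i) c e) := fun c e =>
      isBlockPeriodic_smul (ω i) (hK i (Finset.mem_insert_self i s) c e)
    have hAi : ∀ c e b, AbsMoment₂ (baseKer ((ω i • K i) c e) b) := fun c e =>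
      absMoment₂_baseKer_smul (ω i) (hKA i (Finset.mem_insert_self i s) c e)
    have hPs : ∀ c e, IsBlockPeriodic n ((∑ j ∈ s, ω j • K j) c e) := fun c e => by
      rw [Finset.sum_apply, Finset.sum_apply]
      exact isBlockPeriodic_sum s ω fun j hj => hK j (Finset.mem_insert_of_mem hj) c e
    have hAs : ∀ c e b, AbsMoment₂ (baseKer ((∑ j ∈ s, ω j • K j) c e) b) := fun c e b => by
      rw [Finset.sum_apply, Finset.sum_apply]
      exact absMoment₂_baseKer_sum s ω (fun j hj => hKA j (Finset.mem_insert_of_mem hj) c e) b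
    rw [Finset.sum_insert hi, Finset.sum_insert hi, ih (fun j hj => hK j (Finset.mem_insert_of_mem hj))
      (fun j hj => hKA j (Finset.mem_insert_of_mem hj)), rowDefect_add n hPi hPs hAi hAs, rowDefect_smul]

end Closure

/-! ## §2 Vanishing of the defect from a transfer identity ∕ from first-bond divergence-freeness -/

section Vanish

variable (N) [NeZero N]

/-- [folklore] **ANY PROOF OF THE TRANSFER IDENTITY KILLS THE DEFECT THERE**: if `Σ'_z z_κz_λ·N⁸·dressedEntryP (wK N) P (N•z) a b = avgM2 N (P a b) κ λ`
(block periodic, absolutely summable `P`), then `crossK N P κ λ a b = 0` — subtract part 1's displayed form. -/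
theorem crossK_eq_zero_of_transfer {P : EKer₂ 4} (hP : ∀ c e, IsBlockPeriodic N (P c e))
    (hPA : ∀ c e b, AbsMoment₂ (baseKer (P c e) b)) {κ lam a b : Fin 4}
    (h : ∑' z : Fin 4 → ℤ, ((z κ * z lam : ℤ) : ℝ) * ((N : ℝ) ^ 8 * dressedEntryP (wK N) P ((N : ℤ) • z) a b) = avgM2 N (P a b) κ lam) :
    crossK N P κ lam a b = 0 := by
  have h' := bondSecondMomentP_solutionOp_four_cross N P hP hPA κ lam a b
  rw [h] at h'
  linarith

/-- [folklore] **FIRST-BOND DIVERGENCE-FREENESS + TRANSPOSITION SYMMETRY KILL THE DEFECT AT THE ENTRIES `κ, λ ∈ {a, b}`** — through leaf-02-g4's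
Kronecker-Ward END `FineHessianWardKronecker.bondSecondMomentP_solutionOp_four_of_divFree` (no rows ∕ columns ∕ (T1-avg) hypothesis, no parity). -/
theorem crossK_eq_zero_of_divFree {P : EKer₂ 4} (hP : ∀ c e, IsBlockPeriodic N (P c e))
    (hPA : ∀ c e b, AbsMoment₂ (baseKer (P c e) b)) (hsymm : ∀ c e s s', P c e s s' = P e c s' s)
    (hdiv : ∀ (e : Fin 4) (u' u : Site 4), ∑ c : Fin 4, (P c e (u - Pi.single c 1) u' - P c e u u') = 0)
    {κ lam a b : Fin 4} (hκ : κ = a ∨ κ = b) (hlam : lam = a ∨ lam = b) :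
    crossK N P κ lam a b = 0 :=
  crossK_eq_zero_of_transfer N hP hPA (bondSecondMomentP_solutionOp_four_of_divFree P hP hsymm hdiv hPA hκ hlam)

/-- [folklore] **THE ROW DEFECT OF A TRANSPOSITION-SYMMETRIC, FIRST-BOND DIVERGENCE-FREE KERNEL VANISHES** (the (1.22) entry `(μ,ν)` with weight
`z_μ z_ν` is an entry `κ, λ ∈ {a, b}`).  This is the form the re-cut END's `hWardTot` row feeds. -/
theorem rowDefect_eq_zero_of_divFree {K : EKer₂ 4} (hK : ∀ c e, IsBlockPeriodic N (K c e))
    (hKA : ∀ c e b, AbsMoment₂ (baseKer (K c e) b)) (hsymm : ∀ c e s s', K c e s s' = K e c s' s)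
    (hdiv : ∀ (e : Fin 4) (u' u : Site 4), ∑ c : Fin 4, (K c e (u - Pi.single c 1) u' - K c e u u') = 0) (μ ν : Fin 4) :
    rowDefect N K μ ν = 0 := by
  rw [rowDefect, crossK_eq_zero_of_divFree N hK hKA hsymm hdiv (Or.inl rfl) (Or.inr rfl), mul_zero]

end Vanish

/-! ## §3 The total: weighted pieces, one Ward row -/

section Total

variable (n : ℕ) [NeZero n] {ι : Type*}

/-- [folklore] A weighted finite sum of transposition-symmetric matrix kernels is transposition symmetric. -/
theorem transpose_sum_of_transpose (s : Finset ι) (ω : ι → ℝ) {K : ι → EKer₂ 4}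
    (hKt : ∀ i ∈ s, ∀ c e s' s'', K i c e s' s'' = K i e c s'' s') (c e : Fin 4) (s' s'' : Site 4) :
    (∑ i ∈ s, ω i • K i) c e s' s'' = (∑ i ∈ s, ω i • K i) e c s'' s' := by
  simp only [Finset.sum_apply, Pi.smul_apply, smul_eq_mul]
  exact Finset.sum_congr rfl fun i hi => by rw [hKt i hi]

/-- [folklore] **(K7) USE CLAUSE — THE PIECES' DEFECTS CANCEL IN THE SUM FROM THE TOTAL'S WARD ROW.**  Pieces `K_i` (entries block periodic with
absolutely summable base-point kernels) with weights `ω_i`; IF the TOTAL `Σ_i ω_i • K_i` is transposition symmetric and first-bond divergence-free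
(the re-cut END's single row statement `hWardTot`), THEN `Σ_{i∈s} ω_i · rowDefect n (K_i) μ ν = 0` — NO Ward ∕ parity hypothesis on any piece. -/
theorem sum_rowDefect_eq_zero_of_divFree (s : Finset ι) (ω : ι → ℝ) {K : ι → EKer₂ 4}
    (hK : ∀ i ∈ s, ∀ c e, IsBlockPeriodic n (K i c e)) (hKA : ∀ i ∈ s, ∀ c e b, AbsMoment₂ (baseKer (K i c e) b))
    (hsymm : ∀ c e s' s'', (∑ i ∈ s, ω i • K i) c e s' s'' = (∑ i ∈ s, ω i • K i) e c s'' s')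
    (hdiv : ∀ (e : Fin 4) (u' u : Site 4),
      ∑ c : Fin 4, ((∑ i ∈ s, ω i • K i) c e (u - Pi.single c 1) u' - (∑ i ∈ s, ω i • K i) c e u u') = 0)
    (μ ν : Fin 4) :
    ∑ i ∈ s, ω i * rowDefect n (K i) μ ν = 0 := by
  have hPs : ∀ c e, IsBlockPeriodic n ((∑ j ∈ s, ω j • K j) c e) := fun c e => by
    rw [Finset.sum_apply, Finset.sum_apply]
    exact isBlockPeriodic_sum s ω fun j hj => hK j hj c e
  have hAs : ∀ c e b, AbsMoment₂ (baseKer ((∑ j ∈ s, ω j • K j) c e) b) := fun c e b => by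
    rw [Finset.sum_apply, Finset.sum_apply]
    exact absMoment₂_baseKer_sum s ω (fun j hj => hKA j hj c e) b
  rw [sum_rowDefect_eq n s ω hK hKA, rowDefect_eq_zero_of_divFree n hPs hAs hsymm hdiv]

end Total

end Summit.QuantumFields.BalabanUV.Beta.D1BFx.MomentTransferDefectTotal
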